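import Mathlib
import Literature.Analysis.ValidatedNumerics.TaylorModelIntegralCertTrig
import Literature.Analysis.ValidatedNumerics.TaylorModelExpr
import Summits.Ventures.FusionMHD.Models.CerfonFreidbergIterLikeQHalfMercDefs
import HarnessLib

/-!
# Ventures/FusionMHD — Models/CerfonFreidbergIterLikeQHalfResDefs.lean: the DATA of the two remaining F-INDEPENDENT registers of GGJ's RESISTIVE index `D_R`
# at `ψ_N = 1/2` of THE Cerfon–Freidberg ITER-like instance — `W = ∫ volKernel = ∫ R s/D` and `A_G = ∫ G·volKernel/R² = ∫ G s/(R D)` along ★ #117's approximant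
# (definitions only; no theorem, no `decide`)

HONEST FRAMING (LADDER-GRIDFUSION three columns; CF rung; rider «D_R at ψ_N = 1/2» of the booked row «F2.R2-CF-MERCIER-IMPLICIT» / F3 R3 input (model-6
F3-SCOPING: `D_I/D_R` of a computed-shape surface), model-7 g7).  GGJ's `D_R = D_I + (H − 1/2)²` needs, beyond the six (8.134) registers, `W = ∫ volKernel` and
`A2 = ∫ bsqKernel F = F²·W_R + A_G` (model-7 g6 `resistiveIndex_eq_registerForm_halfLoop`).  THIS FILE: the 9-statement block `block3R` after `progM`
(`1/D = X²D²·w`, `1/(XD) = X·D²·w` with `progM`'s `w = ((XD)²D)⁻¹` — NO new `inv` statement): tops `g_AG = G·m·(XD)⁻¹·p` (depth 0), `g_W = X·m·D⁻¹·p` (depth 1);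
`progR = progM ++ block3R` (685 statements); the per-panel obligation `ResCert.ok` = run accepted ∧ the two panel-integral enclosures inside the claimed
integers.  VALIDATED (never used, genqm/genqr.py): `W = 7.089928`, `A_G = 0.1264530` on `[0, π]`.  MODELLED: analytic Cerfon–Freidberg family; registers of a MODEL
surface — nothing about a device or stability.  Generator `HOME/models/model-7/g7/genqm/genqr.py`.  Typer/prover: gridfusion-model-7 (g7), 2026-08-28.
Citations: Zheng 2015 §3.2 (3.42) [Zheng2015]; Jardin 2010 §5.3 (5.29) [Jardin2010]; Mahboubi–Melquiond–Sibut-Pinote 2016 §3.2–§4.1 [MahboubiMelquiondSibutpinote2016].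
-/

open Literature.Analysis.ValidatedNumerics Literature.Analysis.ValidatedNumerics.PolyMP
open Literature.Analysis.ValidatedNumerics.NumericsMP Literature.Analysis.ValidatedNumerics.ExpPoly

set_option autoImplicit false

namespace Summit.Ventures.FusionMHD.Models.CFIterLike.QHalfRes

set_option maxRecDepth 100000

/-- **`block3R`** — after `QHalfMerc.progM`'s final stack (`w = ((XD)²D)⁻¹` at depth 12, `G` at 24, `X` at 374, `X²` at 371, `D` at 257, `m` at 380): `D·D`, `D²w`,
`1/D = X²·D²·w` (6), `1/(XD) = X·D²·w` (5), `K_W = X·m·D⁻¹` (4), `K_AG = G·m·(XD)⁻¹` (2), tops `g_W` (1), `g_AG` (0). -/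
def block3R : TProg :=
  [TOp.base (SOp.mul 257 257), TOp.base (SOp.mul 0 13), TOp.base (SOp.mul 373 0), TOp.base (SOp.mul 377 1),
   TOp.base (SOp.mul 23 1), TOp.base (SOp.mul 29 385), TOp.base (SOp.mul 0 2), TOp.base (SOp.mul 2 692),
   TOp.base (SOp.mul 1 693)]

/-- **`progR = QHalfMerc.progM ++ block3R`**. -/
def progR : TProg := CFIterLike.QHalfMerc.progM ++ block3R

/-- The register models of `progR` on panel `j` (Taylor degree `deg`; the two `inv` widenings of `progM`). -/
def panelModels (j : ℕ) (cand1 cand2 : List ℤ) (deg e1 e2 : ℕ) : List IPoly × Bool :=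
  progR.model CFIterLike.QHalf.tmS CFIterLike.QHalf.hw deg 14 1 1 40 16 3 (CFIterLike.QHalf.ctr j) (constModels CFIterLike.QHalf.tmS CFIterLike.QHalf.qbox) [(cand1, 2 ^ e1), (cand2, 2 ^ e2)]

/-- **Per-panel resistive-register certificate data**: panel, the two `inv` candidates (as `QHalfMerc.MercCert`), degree, widenings, and the claimed
enclosures of `S·∫_panel g_AG` and `S·∫_panel g_W`. -/
structure ResCert where
  /-- panel index -/
  j : ℕ
  /-- thin candidate for `((XD)²D)⁻¹` -/
  cand1 : List ℤ
  /-- thin candidate for `(XDG)⁻¹` -/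
  cand2 : List ℤ
  /-- Taylor-model degree -/
  deg : ℕ
  /-- `log₂` widening of the first `inv` -/
  e1 : ℕ
  /-- `log₂` widening of the second `inv` -/
  e2 : ℕ
  /-- claimed bounds of `S·∫_panel g_AG` -/
  glo : ℤ
  /-- … -/
  ghi : ℤ
  /-- claimed bounds of `S·∫_panel g_W` -/
  wlo : ℤ
  /-- … -/
  whi : ℤ

/-- **THE PER-PANEL KERNEL OBLIGATION**: run accepted and the two integral enclosures inside the claimed integers. -/
def ResCert.ok (d : ResCert) : Bool :=
  let s := panelModels d.j d.cand1 d.cand2 d.deg d.e1 d.e2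
  let IG := CFIterLike.QHalfMerc.integ s.1 d.j 0
  let IW := CFIterLike.QHalfMerc.integ s.1 d.j 1
  s.2 && decide (d.glo ≤ IG.1) && decide (IG.2 ≤ d.ghi) && decide (d.wlo ≤ IW.1) && decide (IW.2 ≤ d.whi)

end Summit.Ventures.FusionMHD.Models.CFIterLike.QHalfRes
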